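import Summits.QuantumFields.BalabanUV.Beta.D1BFx.LiteralStencilSockets

/-!
# `BalabanUV.Beta.D1BFx.RoadHybPinAn1` — road «BF-x» for binder row D1: **THE [S] SOCKETS OF PART 23-hyb's PIN, DISCHARGED** (an2 g43 RULING R-D1-g43-3 (2):
# «PART 23 := (P-hyb) — the END runs at the road's NATIVE literal: RAW (0.4) tables at `G₀^{bm}(ctrOff 4 n)`; [S] ✓ (leaf-01 §3 RAW)»; binder table
# `HOME/b2b-balaban-beta-d1-p2/PART23-HYB-SPEC.md` §1).  The pinned first-derivative family of PART 22 (`RoadEndBFxRoadScalesJ1RowS.d1Rep_BFx_road_scales_J1row_sbpS`,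
# binder `S : ℕ → Fin 4 → (Fin 4 → ℤ) → MKer 4 (Fib 3)`) is the ODD-INDEXED PIN of d1-formalise-leaf-01's `LiteralStencilSockets` §6 at the RAW member of the
# (III′) literal with an1's tables and the locks read through `Nat.log Lc`:
#   `S n := if h : Odd n then (JsB12CombSh0 (Lc := n) h N (symTablesAn1S2 3 n (cΛ (Nat.log Lc n))) (cΛ (Nat.log Lc n)) (cB (Nat.log Lc n)) 0).S else 0`
# (so that at `n = Lc^m` it IS the raw member of `CombOneShotJets.JcOf hLc N cΛ cB m` — `S_at_pow`).  This file proves, in PART 22's EXACT binder shapes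
# (`∀ n`, no parity hypothesis), the seven structural sockets `hScovB ∕ hSmm ∕ hSfm ∕ hSff ∕ hS ∕ hCs ∕ hδS` of that pin, every one BY NAME from leaf-01's
# per-datum RAW letters (`JsB12CombSh0_S_covB ∕ _an1_inr_inr ∕ _an1_inl_inr ∕ _an1_inl_inl`), the datum's own `JetData.loc ∕ δ_pos`, and the `pin_*` wrappers.
# Nothing of the [M] rows, of (J1) (`hC₁ := Δ_n`), of (J2) or of [W] is touched.

HONEST DEPENDENCY (cell records, verbatim): «continuum YM on T⁴ ⇐ BetaPertH ∧ nine spine estimates (0/9 proved); BetaPertH ⇐ (D1) ∧ (D4) ∧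
CAP+tail; G-an2-4 gates asym, D1 and NE2/3/4.»  HONEST FRAMING (cell contract, verbatim): «discharging `BetaPertH` makes Bałaban's UV stability
UNCONDITIONAL — a real constructive-QFT result; it is NOT the continuum limit and NOT the Clay problem.»  THIS MODULE DISCHARGES NOTHING of (J1),
of (K), of D1 or of the wall: [folklore] `dif_pos ∕ dif_neg` bookkeeping over leaf-01's letters.  No definition, no `def … : Prop`, nothing cited, 0 sorry.
0 root-level binders of row D1 discharged; NOT D1, NOT `BetaPertH`, NOT continuum, NOT Clay.

ABSOLUTE RULE (cell charter, verbatim): «No internally-minted statement may enter as a cited fact. Every hypothesis is either kernel-proved in this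
package or a verbatim quotation of a PUBLISHED theorem with page reference. The manuscript(s) under audit are NOT citable for their own disputed
steps — they are the thing under adjudication; programme-internal (2001/route/tribunal) claims are never citable.»

CONTENT (all [folklore]): `S_at_odd`, `S_at_pow` (the pin read at odd `n` ∕ at the scales `Lc^m`), `S_covB` (`hScovB`), `S_inr_inr` (`hSmm`), `S_inl_inr`
(`hSfm`), `S_inl_inl` (`hSff`), `S_locStencil` (`hS` with the pinned constants), `Cs_nonneg` (`hCs`), `δ_pos` (`hδS`).  Unit `b2b-balaban-beta-d1-p2`
(road owner, gen 22), 2026-08-23.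
-/

noncomputable section

namespace Summit.QuantumFields.BalabanUV.Beta.D1BFx.RoadHybPinAn1

open Literature.MathematicalPhysics.QuantumFieldTheory.Balaban1983to89
open Literature.MathematicalPhysics.QuantumFieldTheory.Balaban1983to89.Beta
open ExpKernelCalculus (MKer shiftK)
open OneStepResolventKernel (Fib JetData LocStencil)
open Summit.QuantumFields.BalabanUV.Beta.SymSecondOrderTablesAn1 (symTablesAn1S2)
open Summit.QuantumFields.BalabanUV.Beta.CombChartStepJets (JsB12CombSh0)
open Summit.QuantumFields.BalabanUV.Beta.D1BFx.LiteralStencilSockets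

variable (Lc : ℕ) (N : ℕ) (cΛ cB : ℕ → ℝ)

/-! ## §1 The pin read at odd blockings and at the scales -/

/-- [folklore] At an odd blocking the pin IS the raw member's first-derivative family. -/
theorem S_at_odd {n : ℕ} (hn : Odd n) :
    (fun n : ℕ => if h : Odd n then (haveI : NeZero n := ⟨h.pos.ne'⟩;
        (JsB12CombSh0 (Lc := n) h N (symTablesAn1S2 3 n (cΛ (Nat.log Lc n))) (cΛ (Nat.log Lc n)) (cB (Nat.log Lc n)) 0).S) else 0) n
      = (haveI : NeZero n := ⟨hn.pos.ne'⟩;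
        (JsB12CombSh0 (Lc := n) hn N (symTablesAn1S2 3 n (cΛ (Nat.log Lc n))) (cΛ (Nat.log Lc n)) (cB (Nat.log Lc n)) 0).S) := by
  simp only [dif_pos hn]

/-- [folklore] **THE PIN AT THE SCALES**: at `n = Lc^m` (`Lc` odd, `1 < Lc`) the pin IS the raw member of the (III′) literal of an1's record at blocking `Lc^m`
with the locks `cΛ m ∕ cB m` (`Nat.log_pow`) — the family whose `hSs` row leaf-01's `RawStencilSupportRows.hSs_raw_scales_an1` serves. -/
theorem S_at_pow [NeZero Lc] (hLc : Odd Lc) (hL : 1 < Lc) (m : ℕ) :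
    (fun n : ℕ => if h : Odd n then (haveI : NeZero n := ⟨h.pos.ne'⟩;
        (JsB12CombSh0 (Lc := n) h N (symTablesAn1S2 3 n (cΛ (Nat.log Lc n))) (cΛ (Nat.log Lc n)) (cB (Nat.log Lc n)) 0).S) else 0) (Lc ^ m)
      = (JsB12CombSh0 (Lc := Lc ^ m) hLc.pow N (symTablesAn1S2 3 (Lc ^ m) (cΛ m)) (cΛ m) (cB m) 0).S := by
  have h : Odd (Lc ^ m) := hLc.pow
  simp only [dif_pos h, Nat.log_pow hL]

/-! ## §2 The four entry sockets `hScovB ∕ hSmm ∕ hSfm ∕ hSff` -/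

/-- [folklore] **`hScovB` OF THE PIN**: block covariance at every blocking (odd: leaf-01's `JsB12CombSh0_S_covB`; even: the zero family). -/
theorem S_covB (n : ℕ) (κ : Fin 4) (u t : Fin 4 → ℤ) :
    (fun n : ℕ => if h : Odd n then (haveI : NeZero n := ⟨h.pos.ne'⟩;
        (JsB12CombSh0 (Lc := n) h N (symTablesAn1S2 3 n (cΛ (Nat.log Lc n))) (cΛ (Nat.log Lc n)) (cB (Nat.log Lc n)) 0).S) else 0) n κ (u + ((n : ℕ) : ℤ) • t)
      = shiftK (-(((n : ℕ) : ℤ) • t)) ((fun n : ℕ => if h : Odd n then (haveI : NeZero n := ⟨h.pos.ne'⟩;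
        (JsB12CombSh0 (Lc := n) h N (symTablesAn1S2 3 n (cΛ (Nat.log Lc n))) (cΛ (Nat.log Lc n)) (cB (Nat.log Lc n)) 0).S) else 0) n κ u) :=
  pin_covB (fun n h => (haveI : NeZero n := ⟨h.pos.ne'⟩;
        (JsB12CombSh0 (Lc := n) h N (symTablesAn1S2 3 n (cΛ (Nat.log Lc n))) (cΛ (Nat.log Lc n)) (cB (Nat.log Lc n)) 0).S))
    (fun n h κ u t => by
    haveI : NeZero n := ⟨h.pos.ne'⟩
    exact JsB12CombSh0_S_covB h N _ _ _ 0 κ u t) n κ u t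

/-- [folklore] **`hSmm` OF THE PIN**: the multiplier–multiplier block vanishes. -/
theorem S_inr_inr (n : ℕ) (κ : Fin 4) (u x y : Fin 4 → ℤ) (c b : Fin 4) :
    (fun n : ℕ => if h : Odd n then (haveI : NeZero n := ⟨h.pos.ne'⟩;
        (JsB12CombSh0 (Lc := n) h N (symTablesAn1S2 3 n (cΛ (Nat.log Lc n))) (cΛ (Nat.log Lc n)) (cB (Nat.log Lc n)) 0).S) else 0) n κ u x y
        (Sum.inr c) (Sum.inr b) = 0 :=
  pin_entry_zero (fun n h => (haveI : NeZero n := ⟨h.pos.ne'⟩;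
        (JsB12CombSh0 (Lc := n) h N (symTablesAn1S2 3 n (cΛ (Nat.log Lc n))) (cΛ (Nat.log Lc n)) (cB (Nat.log Lc n)) 0).S))
    (Sum.inr c) (Sum.inr b) (fun n h κ u x y => by
    haveI : NeZero n := ⟨h.pos.ne'⟩
    exact JsB12CombSh0_S_an1_inr_inr h N _ _ 0 κ u x y c b) n κ u x y

/-- [folklore] **`hSfm` OF THE PIN**: `S n κ u x y (inl c) (inr b) = S n κ u y x (inr b) (inl c)`. -/
theorem S_inl_inr (n : ℕ) (κ : Fin 4) (u x y : Fin 4 → ℤ) (c b : Fin 4) :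
    (fun n : ℕ => if h : Odd n then (haveI : NeZero n := ⟨h.pos.ne'⟩;
        (JsB12CombSh0 (Lc := n) h N (symTablesAn1S2 3 n (cΛ (Nat.log Lc n))) (cΛ (Nat.log Lc n)) (cB (Nat.log Lc n)) 0).S) else 0) n κ u x y
        (Sum.inl c) (Sum.inr b)
      = (fun n : ℕ => if h : Odd n then (haveI : NeZero n := ⟨h.pos.ne'⟩;
        (JsB12CombSh0 (Lc := n) h N (symTablesAn1S2 3 n (cΛ (Nat.log Lc n))) (cΛ (Nat.log Lc n)) (cB (Nat.log Lc n)) 0).S) else 0) n κ u y x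
        (Sum.inr b) (Sum.inl c) := by
  have h := pin_entry (fun n h => (haveI : NeZero n := ⟨h.pos.ne'⟩;
        (JsB12CombSh0 (Lc := n) h N (symTablesAn1S2 3 n (cΛ (Nat.log Lc n))) (cΛ (Nat.log Lc n)) (cB (Nat.log Lc n)) 0).S))
    1 (Sum.inl c) (Sum.inr b) (Sum.inl c) (Sum.inr b) (fun n h κ u x y => by
    haveI : NeZero n := ⟨h.pos.ne'⟩
    rw [one_mul]
    exact JsB12CombSh0_S_an1_inl_inr h N _ _ 0 κ u x y c b) n κ u x y
  rw [one_mul] at h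
  exact h

/-- [folklore] **`hSff` OF THE PIN**: `S n κ u x y (inl c) (inl b) = −S n κ u y x (inl b) (inl c)`. -/
theorem S_inl_inl (n : ℕ) (κ : Fin 4) (u x y : Fin 4 → ℤ) (c b : Fin 4) :
    (fun n : ℕ => if h : Odd n then (haveI : NeZero n := ⟨h.pos.ne'⟩;
        (JsB12CombSh0 (Lc := n) h N (symTablesAn1S2 3 n (cΛ (Nat.log Lc n))) (cΛ (Nat.log Lc n)) (cB (Nat.log Lc n)) 0).S) else 0) n κ u x y
        (Sum.inl c) (Sum.inl b)
      = -(fun n : ℕ => if h : Odd n then (haveI : NeZero n := ⟨h.pos.ne'⟩;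
        (JsB12CombSh0 (Lc := n) h N (symTablesAn1S2 3 n (cΛ (Nat.log Lc n))) (cΛ (Nat.log Lc n)) (cB (Nat.log Lc n)) 0).S) else 0) n κ u y x
        (Sum.inl b) (Sum.inl c) := by
  have h := pin_entry (fun n h => (haveI : NeZero n := ⟨h.pos.ne'⟩;
        (JsB12CombSh0 (Lc := n) h N (symTablesAn1S2 3 n (cΛ (Nat.log Lc n))) (cΛ (Nat.log Lc n)) (cB (Nat.log Lc n)) 0).S))
    (-1) (Sum.inl c) (Sum.inl b) (Sum.inl c) (Sum.inl b) (fun n h κ u x y => by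
    haveI : NeZero n := ⟨h.pos.ne'⟩
    rw [neg_one_mul]
    exact JsB12CombSh0_S_an1_inl_inl h N _ _ 0 κ u x y c b) n κ u x y
  rw [neg_one_mul] at h
  exact h

/-! ## §3 Locality with the pinned constants (`hS ∕ hCs ∕ hδS`) -/

/-- [folklore] **`hS` OF THE PIN**: `LocStencil (S n) (Cs n) (δS n)` with the PINNED constants
`Cs n := if h : Odd n then (the raw member).Cs else 0`, `δS n := if h : Odd n then (the raw member).δ else 1` (the datum's own `JetData.loc`). -/
theorem S_locStencil (n : ℕ) :
    LocStencil
      ((fun n : ℕ => if h : Odd n then (haveI : NeZero n := ⟨h.pos.ne'⟩;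
        (JsB12CombSh0 (Lc := n) h N (symTablesAn1S2 3 n (cΛ (Nat.log Lc n))) (cΛ (Nat.log Lc n)) (cB (Nat.log Lc n)) 0).S) else 0) n)
      ((fun n : ℕ => if h : Odd n then (haveI : NeZero n := ⟨h.pos.ne'⟩;
        (JsB12CombSh0 (Lc := n) h N (symTablesAn1S2 3 n (cΛ (Nat.log Lc n))) (cΛ (Nat.log Lc n)) (cB (Nat.log Lc n)) 0).Cs) else 0) n)
      ((fun n : ℕ => if h : Odd n then (haveI : NeZero n := ⟨h.pos.ne'⟩;
        (JsB12CombSh0 (Lc := n) h N (symTablesAn1S2 3 n (cΛ (Nat.log Lc n))) (cΛ (Nat.log Lc n)) (cB (Nat.log Lc n)) 0).δ) else 1) n) :=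
  pin_locStencil (fun n h => (haveI : NeZero n := ⟨h.pos.ne'⟩;
        (JsB12CombSh0 (Lc := n) h N (symTablesAn1S2 3 n (cΛ (Nat.log Lc n))) (cΛ (Nat.log Lc n)) (cB (Nat.log Lc n)) 0).S))
    (fun n h => (haveI : NeZero n := ⟨h.pos.ne'⟩;
        (JsB12CombSh0 (Lc := n) h N (symTablesAn1S2 3 n (cΛ (Nat.log Lc n))) (cΛ (Nat.log Lc n)) (cB (Nat.log Lc n)) 0).Cs))
    (fun n h => (haveI : NeZero n := ⟨h.pos.ne'⟩;
        (JsB12CombSh0 (Lc := n) h N (symTablesAn1S2 3 n (cΛ (Nat.log Lc n))) (cΛ (Nat.log Lc n)) (cB (Nat.log Lc n)) 0).δ))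
    (fun n h => by
    haveI : NeZero n := ⟨h.pos.ne'⟩
    exact (JsB12CombSh0 (Lc := n) h N (symTablesAn1S2 3 n (cΛ (Nat.log Lc n))) (cΛ (Nat.log Lc n)) (cB (Nat.log Lc n)) 0).loc) n

/-- [folklore] **`hCs` OF THE PIN**: the pinned constants are nonnegative (`JetData.loc` at one entry, `BiLoc.nonneg`). -/
theorem Cs_nonneg (n : ℕ) :
    0 ≤ (fun n : ℕ => if h : Odd n then (haveI : NeZero n := ⟨h.pos.ne'⟩;
        (JsB12CombSh0 (Lc := n) h N (symTablesAn1S2 3 n (cΛ (Nat.log Lc n))) (cΛ (Nat.log Lc n)) (cB (Nat.log Lc n)) 0).Cs) else 0) n :=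
  pin_Cs_nonneg (fun n h => (haveI : NeZero n := ⟨h.pos.ne'⟩;
        (JsB12CombSh0 (Lc := n) h N (symTablesAn1S2 3 n (cΛ (Nat.log Lc n))) (cΛ (Nat.log Lc n)) (cB (Nat.log Lc n)) 0).Cs))
    (fun n h => by
    haveI : NeZero n := ⟨h.pos.ne'⟩
    exact ((JsB12CombSh0 (Lc := n) h N (symTablesAn1S2 3 n (cΛ (Nat.log Lc n))) (cΛ (Nat.log Lc n)) (cB (Nat.log Lc n)) 0).loc 0 0).nonneg
      (Sum.inl 0)) n

/-- [folklore] **`hδS` OF THE PIN**: the pinned rates are positive (`JetData.δ_pos`). -/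
theorem δ_pos (n : ℕ) :
    0 < (fun n : ℕ => if h : Odd n then (haveI : NeZero n := ⟨h.pos.ne'⟩;
        (JsB12CombSh0 (Lc := n) h N (symTablesAn1S2 3 n (cΛ (Nat.log Lc n))) (cΛ (Nat.log Lc n)) (cB (Nat.log Lc n)) 0).δ) else 1) n :=
  pin_δ_pos (fun n h => (haveI : NeZero n := ⟨h.pos.ne'⟩;
        (JsB12CombSh0 (Lc := n) h N (symTablesAn1S2 3 n (cΛ (Nat.log Lc n))) (cΛ (Nat.log Lc n)) (cB (Nat.log Lc n)) 0).δ))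
    (fun n h => by
    haveI : NeZero n := ⟨h.pos.ne'⟩
    exact (JsB12CombSh0 (Lc := n) h N (symTablesAn1S2 3 n (cΛ (Nat.log Lc n))) (cΛ (Nat.log Lc n)) (cB (Nat.log Lc n)) 0).δ_pos) n

end Summit.QuantumFields.BalabanUV.Beta.D1BFx.RoadHybPinAn1

end
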